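import Literature.Geometry.Lorentzian.ImmersedChartRicci
import Literature.Geometry.Lorentzian.SpacetimeLocalConvergence
import HarnessLib

/-!
# Crux `GapExhaustion` (stmt-FinalStateConjecture-10808), line `photon-shell-pseudoconvexity`:
# stub (G5-0) `stub_isMetricOn_metricInCoords` — the components of an immersed chart are a metric datum

Route `BartnikGapSettling`; helper (`--supports stmt-FinalStateConjecture-10808`) landing the
registered sub-stub (G5-0) of theme G5 (the chart bridge between the manifold-level
`IsKillingFieldOn` of the node and the coordinate Killing equation of §1e, line lead c8): for a
spacetime `𝓢`, a map `Ψ : E4 → 𝓢.carrier` which is `C^∞` on an open set `W ⊆ E4` with injective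
differential at every point of `W` (an immersed chart; `dim E4 = dim 𝓢 = 4`), the coordinate
components `𝓢.metricInCoords Ψ : E4 → E4 →L[ℝ] E4 →L[ℝ] ℝ`, `y ↦ ((v, w) ↦ g_{Ψ y}(dΨ_y v, dΨ_y w))`
(`Spacetime.metricInCoords`, definitionally `pullbackBilin Ψ 𝓢.metric.val`), are a metric datum
on `W` in the sense of the coordinate calculus of `CoordCurvature.lean`
(`MetricCoord.IsMetricOn`: `W` open, the components `C^∞` on `W`, symmetric and invertible at
every point of `W`), so that the coordinate identities of §1e apply to them.

Proof: this is `isMetricOn_pullbackBilin_immersedChart` (`ImmersedChartRicci.lean`, O'Neill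
1983, Ch. 3, Def. 3.1: the pullback metric `Ψ^* g` on the open submanifold `W` has
representative `pullbackBilin Ψ g.val`) for the pseudo-Riemannian metric underlying
`𝓢.metric`, the open set `⟨W, hW⟩ : Opens E4` and `dim E4 = dim E4`; the two component fields
agree definitionally.
-/

noncomputable section

-- instance search through the nested operator types `E4 →L[ℝ] E4 →L[ℝ] ℝ`
set_option maxSynthPendingDepth 3

-- D-0017: single-problem summit, `Summit.<S>.<S>.…` by design (cf. lakefile `weak.linter.dupNamespace`).
set_option linter.dupNamespace false

namespace Summit.FinalStateConjecture.FinalStateConjecture.Theorems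

open Set Literature.Geometry.Lorentzian Literature.Geometry.Lorentzian.MetricCoord
open scoped Manifold ContDiff Topology

/-- **(G5-0) The components of an immersed chart of a spacetime are a metric datum.** For a
spacetime `𝓢`, `Ψ : E4 → 𝓢.carrier` smooth on the open set `W` with injective differential on
`W`, the components `𝓢.metricInCoords Ψ` are `MetricCoord.IsMetricOn` on `W` (open domain,
`C^∞`, symmetric, invertible). Special case `F = E4`, `A = ⟨W, hW⟩`, `g = 𝓢.metric` of
`isMetricOn_pullbackBilin_immersedChart`. [cite: ONeill1983, Ch. 3, Def. 3.1] -/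
theorem stub_isMetricOn_metricInCoords :
    ∀ (𝓢 : Spacetime.{0} 4) (Ψ : E4 → 𝓢.carrier) (W : Set E4),
      IsOpen W → ContMDiffOn 𝓘(ℝ, E4) (𝓡 4) ∞ Ψ W →
      (∀ y ∈ W, Function.Injective (mfderiv 𝓘(ℝ, E4) (𝓡 4) Ψ y)) →
      IsMetricOn (𝓢.metricInCoords Ψ) W := by
  intro 𝓢 Ψ W hW hΨ hinj
  exact isMetricOn_pullbackBilin_immersedChart (A := (⟨W, hW⟩ : TopologicalSpace.Opens E4))
    𝓢.metric.toPseudoRiemannianMetric hΨ hinj rfl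

end Summit.FinalStateConjecture.FinalStateConjecture.Theorems

end
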